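import Summits.QuantumAdvantage.QuantumAdvantage.Theorems.AbelianDialA

/-! # AbelianDialB — part 2/5 of the landing twins of NODE «AbelianDial» (decomp-qadv lens-2; node file
`g23/AbelianDial.lean`, sha256 4845a3792d6530ec…; generator `g23/tree/gen_twins.py`: namespace
`Theses.AbelianDial` → `Theorems.AbelianDial`, cut at declaration boundaries, docstrings added where missing, nothing else).
Content: §3 the decided sub-rung of GAPPED tables (`gappedTableLoss`, tree dark-window law) and §3b the decided TYPE `(1,1)`
(PARITY tables: `alin2_orbF`, `parity_addResp`, `parityTableLoss`, `abelianLoss3_one_one` = the `(1,1)`-instance of `AbelianLoss3`, tree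
additive-response law). -/

set_option linter.dupNamespace false
noncomputable section
open scoped Classical

namespace Summit.QuantumAdvantage.QuantumAdvantage.Theorems.AbelianDial
open Finset
open Literature.Computability.QuantumComplexity Literature.Computability.QuantumComplexity.RingHLF
open Literature.Computability.MetaComplexity Literature.Computability.MetaComplexity.Smolensky
open Summit.QuantumAdvantage.AdviceFreeQNC0
open Summit.QuantumAdvantage.QuantumAdvantage.Theorems.AnchorDial (outB dev orbF oddZeros_orbF orbF_apply_of_far
  card_filter_orbF card_odd_ge loss_shape_mono)
open Summit.QuantumAdvantage.QuantumAdvantage.Theorems.HolonomyDial (tPoly tPoly_apply tPoly_mem xorP xorP_mem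
  xorP_apply_bool indP indP_apply indP_mem mono_singleton_apply)
open Summit.QuantumAdvantage.QuantumAdvantage.Theorems.StabilizerDial (apIdx apStrat apStrat_mem bitP bitP_apStrat pad
  pad_mem rel_pad_iff StabFew outB_pad_pad outB_pad_congr bitP_gsum gsum gsum_mem deg_gsum dev_congr)
open Summit.QuantumAdvantage.QuantumAdvantage.Theorems.SparsityDial (real_loss_of_frac stabFew_mono_mr one_le_logpow)
open Summit.QuantumAdvantage.QuantumAdvantage.Theorems.ResponseDial (mem_dev_apStrat dev_pad_zero
  not_polylogSparse_of_agree AddResp additive_loss_count lodd lodd_mem lodd_eq_sum lodd_orbF oddSite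
  oddSite_val oddSite_odd card_exists_orbF_le fibre_le_pow orbF_apply)
open Summit.QuantumAdvantage.QuantumAdvantage.Theorems.CounterDial (bsel mem_iff_bsel)
open Summit.QuantumAdvantage.QuantumAdvantage.Theorems.CounterDial (lin CounterForm StabCounter Dark dw dw_apply_of_far
  oddZeros_dw dark_loss_count)
open Summit.QuantumAdvantage.QuantumAdvantage.Theorems.BlindDial (apIdx_val_first)

variable {N : ℕ}

/-! ## §3  A DECIDED sub-rung of the special piece: every GAPPED table loses (the tree's dark-window law) -/

/-- a table (at some gauge) all of whose forms vanish on the four cells `b … b+3` is DARK there at every odd input. -/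
theorem table_dark {m r : ℕ} {v : Fin N → Fin N → Fin r → ZMod (m + 1)} {G : Fin N → (Fin r → ZMod (m + 1)) → Bool}
    {Q : Fin N → CubeFn (ZMod 3) N} (hT : TableForm m r v G Q) {b : ℕ} (hb : b + 5 ≤ N)
    (hgap : ∀ k i, b ≤ i.val → i.val ≤ b + 3 → v k i = 0) (x : Fin N → Bool) (hx : OddZeros x) : Dark b Q x := by
  intro ε
  ext k
  rw [hT (dw b ε x) ((oddZeros_dw hb ε x).2 hx) k, hT x hx k]
  have e : alin m r (v k) (dw b ε x) = alin m r (v k) x := by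
    funext j
    refine sum_congr rfl fun i _ => ?_
    by_cases hi : b ≤ i.val ∧ i.val ≤ b + 3
    · rw [hgap k i hi.1 hi.2]; simp
    · rw [dw_apply_of_far b ε x i (by omega)]
  rw [e]

/-- **decided sub-rung (counting form)**: a gapped table-form field loses at least an eighth of the odd class. -/
theorem gapped_table_loss (hN : 3 ≤ N) {m r : ℕ} {v : Fin N → Fin N → Fin r → ZMod (m + 1)}
    {G : Fin N → (Fin r → ZMod (m + 1)) → Bool} {Q : Fin N → CubeFn (ZMod 3) N} (hT : TableForm m r v G Q)
    {b : ℕ} (hb : b + 5 ≤ N) (hgap : ∀ k i, b ≤ i.val → i.val ≤ b + 3 → v k i = 0) :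
    (univ.filter fun x : Fin N → Bool => OddZeros x).card ≤
      8 * (univ.filter fun x : Fin N → Bool => OddZeros x ∧ ¬ Rel x (outB Q x)).card := by
  refine le_trans (le_of_eq (congrArg card (filter_congr fun x _ => ?_))) (dark_loss_count hN hb Q)
  exact ⟨fun hx => ⟨hx, table_dark hT hb hgap x hx⟩, fun h => h.1⟩

/-- **decided sub-rung (the piece's format, `C = 1`)**: a strategy with a cheap GAPPED table (any type, any gauge) wins
at most `(1 - 1/n) · 2^{n-1}` odd inputs (`n ≥ 8`). The gap is what the open core of `AbelianLoss3` lacks. -/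
theorem gappedTableLoss {n : ℕ} (hn : 8 ≤ n) (P s : Fin n → CubeFn (ZMod 3) n) {m r : ℕ}
    {v : Fin n → Fin n → Fin r → ZMod (m + 1)} {G : Fin n → (Fin r → ZMod (m + 1)) → Bool}
    (hT : TableForm m r v G (pad P s)) {b : ℕ} (hb : b + 5 ≤ n) (hgap : ∀ k i, b ≤ i.val → i.val ≤ b + 3 → v k i = 0) :
    ((univ.filter fun x : Fin n → Bool => OddZeros x ∧ Rel x (fun i => decide (P i x = 1))).card : ℝ) ≤
      (1 - 1 / (n : ℝ) ^ 1) * (2 : ℝ) ^ (n - 1) := by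
  refine real_loss_of_frac (M := 8) (by norm_num) hn (by omega) P ?_
  have h := gapped_table_loss (by omega) hT hb hgap
  have e : (univ.filter fun x : Fin n → Bool => OddZeros x ∧ ¬ Rel x (outB (pad P s) x)) =
      (univ.filter fun x : Fin n → Bool => OddZeros x ∧ ¬ Rel x (outB P x)) :=
    filter_congr fun x _ => by rw [rel_pad_iff]
  rw [e] at h
  exact h

/-! ## §3b  A second DECIDED sub-rung: every PARITY table (type `(1,1)`) loses — the tree's ADDITIVE-RESPONSE law
The base case of the 2-group observation of the module docstring, provable with in-tree engines only: a gate that is a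
Boolean function of ONE `Z₂`-linear form responds ADDITIVELY to pair flips (`AddResp`, tree `ResponseDialA`) at every
odd input along the fixed separated sites `4i` — over `Z₂` the direction of a flip is invisible — so the tree's
`additive_loss_count` gives `#odd ≤ 32 · #losers`.  (`r ≥ 2`, e.g. an AND of two parities, has echo degree `r`: g22's engine.) -/

/-- the five flip sites `4i` (pairs `{4i, 4i+1}`): separated, and fitting once `19 ≤ N`. -/
def b4 : Fin 5 → ℕ := fun i => 4 * i.val

/-- the sites `4i` are pairwise separated (`4i + 2 ≤ 4j` for `i < j`). -/
theorem b4_sep : ∀ i j : Fin 5, i < j → b4 i + 2 ≤ b4 j := by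
  intro i j h; have := Fin.lt_def.1 h; unfold b4; omega

/-- the sites `4i` fit below `N` once `19 ≤ N`. -/
theorem b4_le (hN : 19 ≤ N) : ∀ i : Fin 5, b4 i + 3 ≤ N := by
  intro i; have := i.isLt; unfold b4; omega

/-- the two cells `4i`, `4i+1` of flip pair `i`. -/
def p0 (hN : 19 ≤ N) (i : Fin 5) : Fin N := ⟨4 * i.val, by have := i.isLt; omega⟩
/-- see `p0`. -/
def p1 (hN : 19 ≤ N) (i : Fin 5) : Fin N := ⟨4 * i.val + 1, by have := i.isLt; omega⟩

/-- **a `Z₂`-linear form along a pair-flip orbit** moves by the sum of the coefficients of the flipped cells. -/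
theorem alin2_orbF (hN : 19 ≤ N) (w : Fin N → Fin 1 → ZMod (1 + 1)) (ε : Fin 5 → Bool) (x : Fin N → Bool) :
    alin 1 1 w (orbF b4 ε x) 0 =
      alin 1 1 w x 0 + ∑ i ∈ (univ : Finset (Fin 5)).filter (fun i => ε i = true), (w (p0 hN i) 0 + w (p1 hN i) 0) := by
  unfold alin
  have h2 : ∀ u : ZMod (1 + 1), u + u = 0 := by decide
  have hpt : ∀ j ∈ (univ : Finset (Fin N)),
      (if orbF b4 ε x j then w j 0 else 0) =
        (if x j then w j 0 else 0) +
          (if (∃ i, ε i = true ∧ (j.val = b4 i ∨ j.val = b4 i + 1)) then w j 0 else 0) := by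
    intro j _
    rw [orbF_apply b4_sep ε x j]
    by_cases h : ∃ i, ε i = true ∧ (j.val = b4 i ∨ j.val = b4 i + 1)
    · rw [if_pos h, if_pos h]; cases x j <;> simp [h2]
    · rw [if_neg h, if_neg h, add_zero]
  rw [sum_congr rfl hpt, sum_add_distrib]
  congr 1
  rw [← sum_filter]
  have hset : (univ : Finset (Fin N)).filter (fun j => ∃ i, ε i = true ∧ (j.val = b4 i ∨ j.val = b4 i + 1)) =
      ((univ : Finset (Fin 5)).filter (fun i => ε i = true)).biUnion (fun i => {p0 hN i, p1 hN i}) := by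
    ext j
    simp only [mem_filter, mem_univ, true_and, mem_biUnion, mem_insert, mem_singleton]
    constructor
    · rintro ⟨i, hi, hj⟩
      refine ⟨i, hi, ?_⟩
      rcases hj with hj | hj
      · exact Or.inl (Fin.ext hj)
      · exact Or.inr (Fin.ext hj)
    · rintro ⟨i, hi, hj⟩
      refine ⟨i, hi, ?_⟩
      rcases hj with rfl | rfl
      · exact Or.inl rfl
      · exact Or.inr rfl
  rw [hset, sum_biUnion]
  · refine sum_congr rfl fun i _ => ?_
    rw [sum_pair]
    intro h
    have := congrArg Fin.val h
    simp [p0, p1] at this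
  · intro i _ j _ hij
    have hv : i.val ≠ j.val := fun h => hij (Fin.ext h)
    simp only [Function.onFun]
    rw [disjoint_left]
    intro c hc hc'
    simp only [mem_insert, mem_singleton] at hc hc'
    rcases hc with rfl | rfl <;> rcases hc' with h | h <;>
      · have := congrArg Fin.val h; simp [p0, p1] at this; omega

/-- every PARITY-TABLE field responds ADDITIVELY along the sites `4i`, at every odd input: flipping pair `i` toggles
position `k` iff its gate is non-constant and the pair's two coefficients sum to `1`. -/
theorem parity_addResp (hN : 19 ≤ N) {v : Fin N → Fin N → Fin 1 → ZMod (1 + 1)}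
    {G : Fin N → (Fin 1 → ZMod (1 + 1)) → Bool} {Q : Fin N → CubeFn (ZMod 3) N} (hT : TableForm 1 1 v G Q)
    (x : Fin N → Bool) (hx : OddZeros x) :
    AddResp b4 Q (fun i => univ.filter fun k : Fin N =>
      G k (fun _ => 0) ≠ G k (fun _ => 1) ∧ v k (p0 hN i) 0 + v k (p1 hN i) 0 = 1) x := by
  intro ε k
  have hxo : OddZeros (orbF b4 ε x) := (oddZeros_orbF (b4_le hN) ε x).2 hx
  have rd : ∀ y : Fin N → Bool, alin 1 1 (v k) y = fun _ => alin 1 1 (v k) y 0 := fun y => by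
    funext j; rw [Fin.eq_zero j]
  have hT' : ∀ y, OddZeros y → (k ∈ dev Q y ↔ G k (fun _ => alin 1 1 (v k) y 0) = true) := fun y hy => by
    rw [hT y hy k, ← rd y]
  rw [hT' _ hxo, hT' x hx, alin2_orbF hN (v k) ε x]
  set a := alin 1 1 (v k) x 0 with ha
  set E := (univ : Finset (Fin 5)).filter (fun i => ε i = true) with hE
  set d : Fin 5 → ZMod (1 + 1) := fun i => v k (p0 hN i) 0 + v k (p1 hN i) 0 with hd
  have h01 : ∀ u : ZMod (1 + 1), (if u = 1 then (1 : ZMod (1 + 1)) else 0) = u := by decide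
  have hD : ∑ i ∈ E, d i = ((E.filter fun i => d i = 1).card : ZMod (1 + 1)) := by
    rw [Finset.natCast_card_filter]
    exact sum_congr rfl fun i _ => (h01 (d i)).symm
  have hDs : ∑ i ∈ E, (v k (p0 hN i) 0 + v k (p1 hN i) 0) = ∑ i ∈ E, d i := rfl
  rw [hDs, hD]
  by_cases hg : G k (fun _ => 0) ≠ G k (fun _ => 1)
  · have hcnt : (univ.filter fun i : Fin 5 => ε i = true ∧ k ∈ univ.filter (fun k : Fin N =>
        G k (fun _ => 0) ≠ G k (fun _ => 1) ∧ v k (p0 hN i) 0 + v k (p1 hN i) 0 = 1)).card =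
        (E.filter fun i => d i = 1).card := by
      rw [hE, filter_filter]
      congr 1
      refine filter_congr fun i _ => ?_
      simp only [mem_filter, mem_univ, true_and, hd]
      exact ⟨fun h => ⟨h.1, h.2.2⟩, fun h => ⟨h.1, hg, h.2⟩⟩
    rw [hcnt]
    have hg' : ∀ t : ZMod (1 + 1), G k (fun _ => t) = if t = 0 then G k (fun _ => 0) else G k (fun _ => 1) := by
      intro t; fin_cases t <;> rfl
    have key : ∀ u w : Bool, u ≠ w → ∀ a' : ZMod (1 + 1), ∀ M : ℕ, M ≤ 5 →
        ((if a' + (M : ZMod (1 + 1)) = 0 then u else w) = true ↔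
          ((if a' = 0 then u else w) = true ↔ M % 2 = 0)) := by decide
    rw [hg', hg' a]
    exact key _ _ hg a _ (le_trans (card_le_card (filter_subset _ _))
      (le_trans (card_le_card (filter_subset _ _)) (by simp)))
  · rw [not_ne_iff] at hg
    have hcnt : (univ.filter fun i : Fin 5 => ε i = true ∧ k ∈ univ.filter (fun k : Fin N =>
        G k (fun _ => 0) ≠ G k (fun _ => 1) ∧ v k (p0 hN i) 0 + v k (p1 hN i) 0 = 1)).card = 0 := by
      rw [card_eq_zero, filter_eq_empty_iff]
      intro i _ h
      rw [mem_filter] at h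
      exact h.2.2.1 hg
    rw [hcnt]
    have hc : ∀ t : ZMod (1 + 1), G k (fun _ => t) = G k (fun _ => 0) := by
      intro t; fin_cases t
      · rfl
      · exact hg.symm
    rw [hc, hc a]
    simp

/-- **decided sub-rung (counting form)**: a parity-table field loses at least a 32nd of the odd class. -/
theorem parity_table_loss (hN : 19 ≤ N) {v : Fin N → Fin N → Fin 1 → ZMod (1 + 1)}
    {G : Fin N → (Fin 1 → ZMod (1 + 1)) → Bool} {Q : Fin N → CubeFn (ZMod 3) N} (hT : TableForm 1 1 v G Q) :
    (univ.filter fun x : Fin N → Bool => OddZeros x).card ≤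
      32 * (univ.filter fun x : Fin N → Bool => OddZeros x ∧ ¬ Rel x (outB Q x)).card := by
  refine le_trans (card_le_card fun x hx => ?_) (additive_loss_count (by omega) b4_sep (b4_le hN) Q)
  rw [mem_filter] at hx ⊢
  exact ⟨hx.1, hx.2, _, parity_addResp hN hT x hx.2⟩

/-- **decided sub-rung (the piece's format, `C = 1`)**: a strategy with a cheap PARITY table (type `(1,1)`, any gauge)
wins at most `(1 - 1/n) · 2^{n-1}` odd inputs (`n ≥ 32`). -/
theorem parityTableLoss {n : ℕ} (hn : 32 ≤ n) (P s : Fin n → CubeFn (ZMod 3) n)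
    {v : Fin n → Fin n → Fin 1 → ZMod (1 + 1)} {G : Fin n → (Fin 1 → ZMod (1 + 1)) → Bool}
    (hT : TableForm 1 1 v G (pad P s)) :
    ((univ.filter fun x : Fin n → Bool => OddZeros x ∧ Rel x (fun i => decide (P i x = 1))).card : ℝ) ≤
      (1 - 1 / (n : ℝ) ^ 1) * (2 : ℝ) ^ (n - 1) := by
  refine real_loss_of_frac (M := 32) (by norm_num) hn (by omega) P ?_
  have h := parity_table_loss (by omega) hT
  have e : (univ.filter fun x : Fin n → Bool => OddZeros x ∧ ¬ Rel x (outB (pad P s) x)) =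
      (univ.filter fun x : Fin n → Bool => OddZeros x ∧ ¬ Rel x (outB P x)) :=
    filter_congr fun x _ => by rw [rel_pad_iff]
  rw [e] at h
  exact h

/-- **the type-`(1,1)` INSTANCE of the special piece `AbelianLoss3`, PROVED** (`a = 0`, `C = 1`, `n₀ = 32`; the
density and non-counter hypotheses are not even used): every cheaply PARITY-TABLE strategy loses polynomially. -/
theorem abelianLoss3_one_one : ∃ a : ℕ, ∃ C : ℕ, ∀ c : ℕ, ∃ n₀ : ℕ, ∀ n ≥ n₀, ∀ P : Fin n → CubeFn (ZMod 3) n,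
    (∀ i, P i ∈ lowDeg (ZMod 3) n ((Nat.log 2 n) ^ c)) →
      ¬ StabFew ((Nat.log 2 n) ^ a) 0 (c + 1) P → ¬ StabCounter (c + 1) P → StabTable 1 1 (c + 1) P →
        ((univ.filter fun x : Fin n → Bool =>
            OddZeros x ∧ Rel x (fun i => decide (P i x = 1))).card : ℝ)
          ≤ (1 - 1 / (n : ℝ) ^ C) * (2 : ℝ) ^ (n - 1) :=
  ⟨0, 1, fun _ => ⟨32, fun n hn P _ _ _ hT => by
    obtain ⟨s, -, v, G, h⟩ := hT
    exact parityTableLoss hn P s h⟩⟩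

end Summit.QuantumAdvantage.QuantumAdvantage.Theorems.AbelianDial
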